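import Summits.BirchSwinnertonDyer.BirchSwinnertonDyer.Theorems.AlignedTransportAtTwoMainConjectureOfRankZeroBSDAtTwoFineRoadCoinvDefect
import HarnessLib

/-!
# Route `AlignedTransportAtTwo`, crux C2 `MainConjectureOfRankZeroBSDAtTwo` (stmt-BirchSwinnertonDyer-22298):
# road (b) over `ℚ_∞` — the EXACT accounting of Kato's four-term sequence at the prime `(2)`

HONEST FRAMING (cell `bsd-f1-sign2`, WIDTH-5 attached prover seat `bsd-line-att-p3` gen 3, line `birth` of the
lead `bsd-line-att-p2`; BSD is NOT proved by any of this). THEOREMS ONLY; nothing asserted. The line's road (b)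
(`…FineRoad.lengthAt_le_of_fineSkeleton`, p593068) books Kato's §17.13 row over `ℚ_∞` as an INEQUALITY
`μ(X) ≤ μ(ker col) + n + μ(G) + μ(X₀)`. REF1-AUDIT §62 (S1) observed that with the row EXACT (compact Selmer
module `H¹_{f,Iw}(ℚ_∞, T₂E) = 0`, Kato 12.4, so `𝐇 → P` is injective and `0 → 𝐇/Λz⁺ → P/Λ·loc z⁺ → X → X₀ → 0`
is exact) the bookkeeping is an EQUALITY, which locates the `Δ_E > 0` residue of the crux in ONE number: the
`(2)`-length of `𝐇/Λz⁺`, i.e. how `2`-divisible Kato's `ℚ_∞`-zeta class is in `𝐇 = H¹_Iw(ℤ[1/2N]; ℚ_∞, T₂E)`.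
This file is that accounting as kernel algebra:

* §1 (any commutative ring) `lengthAt_add_eq_of_fourTerm` — for `0 → A → B → X → Y → 0` exact:
  `ℓ(A) + ℓ(X) = ℓ(B) + ℓ(Y)`; `lengthAt_quotient_span_add_coker_eq` — for an injective `col : P → R` and
  `w ∈ P`: `ℓ(P/R·w) + ℓ(R/col(P)) = ℓ(R/(col w))`; assembled: `lengthAt_fourTerm_accounting`.
* §2 at `𝔭 = (p)`: `lengthAt_fourTerm_accounting_augIdealP` — with `col (loc z) = p^e·s·G`, `s ∉ (p)`:
  `ℓ(H/Λz) + ℓ(X) + ℓ(Λ/col P) = e + ℓ(Λ/(G)) + ℓ(Y)`.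
* §3 at `2`, per cyclotomic datum (`X = X(E/ℚ_∞)` strict, `Y = X₀(E/ℚ_∞)` strict; data DISPLAYED: Kato's
  Poitou–Tate row over `ℚ_∞` with `𝐇 ↪ P` and exactness at `P`, a Coleman map with `(2)`-length-`0` cokernel,
  the integral class with `col(loc z) = 2^e·s·G₊` — REF1 §57: `e = [Δ_E > 0]` —, statement (A) at `(E,2)`,
  even-branch `μ₂ = 0`): `selmerDual_lengthAt_add_zetaIndex_eq_two` : `ℓ₍₂₎(𝐇/Λz) + ℓ₍₂₎(X(E/ℚ_∞)) = e`;
  hence `selmerDual_lengthAt_le_defect_two` : `ℓ₍₂₎(X(E/ℚ_∞)) ≤ e` (so `μ ≤ 1` at `Δ_E > 0`, `μ = 0` at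
  `Δ_E < 0`, modulo the displayed data) and `selmerDual_mu_eq_zero_iff_zetaIndex_two` : `μ(X(E/ℚ_∞)) = 0 ↔
  ℓ₍₂₎(𝐇/Λz) = e` — stub T on road (b) ⟺ «Kato's `ℚ_∞`-class is `μ`-divisible in `𝐇` by exactly `2^{[Δ_E>0]}`»
  (REF1 §62 (S1): ⟺ the real-signature map `loc_∞ : 𝐇 → Λ/2` is non-zero, since `loc_∞(z⁺) = 0` for a class
  corestricted from the totally imaginary `ℚ(ζ_{2^∞})`). Nothing here asserts which case holds.

References: K. Kato, Astérisque 295 (2004), Thm. 12.4, Thm. 12.5 (4), Thm. 17.4 (1), Prop. 17.11, §17.13;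
R. Greenberg, LNM 1716 (1999) §4; J. Coates, R. Sujatha, Math. Ann. 331 (2005) §3.
-/

set_option linter.dupNamespace false
set_option autoImplicit false

noncomputable section

open scoped Classical

open Literature.NumberTheory.EllipticCurves Literature.NumberTheory.EllipticCurves.Module

namespace Summit.BirchSwinnertonDyer.BirchSwinnertonDyer.Theorems.AlignedTransportAtTwoFineRoad

/-! ## §1 Exact bookkeeping over a commutative ring -/

section FourTerm

variable {R : Type*} [CommRing R]
  {A B X Y P : Type*} [AddCommGroup A] [_root_.Module R A] [AddCommGroup B] [_root_.Module R B]
  [AddCommGroup X] [_root_.Module R X] [AddCommGroup Y] [_root_.Module R Y]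
  [AddCommGroup P] [_root_.Module R P]

/-- **Euler characteristic of a four-term exact sequence.** For `0 → A → B → X → Y → 0` exact
(`ι` injective, exact at `B` and at `X`, `π` onto): `ℓ_𝔭(A) + ℓ_𝔭(X) = ℓ_𝔭(B) + ℓ_𝔭(Y)` at every prime
(lengths in `ℕ∞`; no finiteness needed). [folklore] -/
theorem lengthAt_add_eq_of_fourTerm (ι : A →ₗ[R] B) (hι : Function.Injective ι) (f : B →ₗ[R] X)
    (hιf : Function.Exact ι f) (π : X →ₗ[R] Y) (hfπ : Function.Exact f π) (hπ : Function.Surjective π)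
    (𝔭 : PrimeSpectrum R) :
    lengthAt R A 𝔭 + lengthAt R X 𝔭 = lengthAt R B 𝔭 + lengthAt R Y 𝔭 := by
  have h1 : LinearMap.range ι = LinearMap.ker f := (LinearMap.exact_iff.mp hιf).symm
  have h2 : LinearMap.range f = LinearMap.ker π := (LinearMap.exact_iff.mp hfπ).symm
  have hA : lengthAt R (LinearMap.range ι) 𝔭 = lengthAt R A 𝔭 :=
    (lengthAt_eq_of_linearEquiv (LinearEquiv.ofInjective ι hι) 𝔭).symm
  have hBq : lengthAt R (B ⧸ LinearMap.range ι) 𝔭 = lengthAt R (LinearMap.ker π) 𝔭 :=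
    lengthAt_eq_of_linearEquiv
      ((Submodule.quotEquivOfEq _ _ h1).trans (f.quotKerEquivRange.trans (LinearEquiv.ofEq _ _ h2))) 𝔭
  have hB : lengthAt R B 𝔭 = lengthAt R A 𝔭 + lengthAt R (LinearMap.ker π) 𝔭 := by
    rw [lengthAt_eq_add_quotient (LinearMap.range ι) 𝔭, hA, hBq]
  have hX : lengthAt R X 𝔭 = lengthAt R (LinearMap.ker π) 𝔭 + lengthAt R Y 𝔭 := by
    rw [lengthAt_eq_add_quotient (LinearMap.ker π) 𝔭,
      lengthAt_eq_of_linearEquiv (π.quotKerEquivOfSurjective hπ) 𝔭]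
  rw [hB, hX, add_assoc]

/-- **The zeta line inside an injective Coleman map.** For `col : P → R` injective and `w ∈ P`:
`ℓ_𝔭(P/R·w) + ℓ_𝔭(R/col(P)) = ℓ_𝔭(R/(col w))` (the short exact sequence
`0 → P/R·w → R/(col w) → R/col(P) → 0`). [folklore] -/
theorem lengthAt_quotient_span_add_coker_eq (col : P →ₗ[R] R) (hcol : Function.Injective col) (w : P)
    (𝔭 : PrimeSpectrum R) :
    lengthAt R (P ⧸ (R ∙ w)) 𝔭 + lengthAt R (R ⧸ LinearMap.range col) 𝔭 =
      lengthAt R (R ⧸ Ideal.span {col w}) 𝔭 := by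
  set I : Ideal R := Ideal.span {col w} with hI
  have hIle : (I : Submodule R R) ≤ LinearMap.range col := by
    rw [hI, Ideal.span, Submodule.span_singleton_le_iff_mem]
    exact ⟨w, rfl⟩
  let φ : P →ₗ[R] R ⧸ I := I.mkQ ∘ₗ col
  have hker : LinearMap.ker φ = R ∙ w := by
    ext x
    rw [LinearMap.mem_ker, LinearMap.comp_apply, Submodule.mkQ_apply, Submodule.Quotient.mk_eq_zero, hI,
      Ideal.mem_span_singleton', Submodule.mem_span_singleton]
    constructor
    · rintro ⟨a, ha⟩
      refine ⟨a, hcol ?_⟩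
      rw [map_smul, smul_eq_mul, ha]
    · rintro ⟨a, rfl⟩
      exact ⟨a, by rw [map_smul, smul_eq_mul]⟩
  have hrange : LinearMap.range φ = (LinearMap.range col).map I.mkQ := LinearMap.range_comp _ _
  have h1 : lengthAt R (LinearMap.range φ) 𝔭 = lengthAt R (P ⧸ (R ∙ w)) 𝔭 :=
    (lengthAt_eq_of_linearEquiv ((Submodule.quotEquivOfEq _ _ hker).symm.trans φ.quotKerEquivRange) 𝔭).symm
  have h2 : lengthAt R ((R ⧸ I) ⧸ LinearMap.range φ) 𝔭 = lengthAt R (R ⧸ LinearMap.range col) 𝔭 := by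
    rw [lengthAt_eq_of_linearEquiv (Submodule.quotEquivOfEq _ _ hrange) 𝔭]
    exact lengthAt_eq_of_linearEquiv (Submodule.quotientQuotientEquivQuotient _ _ hIle) 𝔭
  rw [lengthAt_eq_add_quotient (LinearMap.range φ) 𝔭, h1, h2]

variable {H : Type*} [AddCommGroup H] [_root_.Module R H]

/-- **EXACT ACCOUNTING of Kato's four-term row (any commutative ring, any prime).** Data: `loc : H → P`
INJECTIVE with `H → P → X` exact at `P` (compact Selmer module zero), `P → X → Y → 0` exact, an injective
Coleman map `col : P → R`, a class `z ∈ H`. Then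
`ℓ(H/R·z) + ℓ(X) + ℓ(R/col P) = ℓ(R/(col (loc z))) + ℓ(Y)`.
[cite: Kato2004Asterisque, Thm. 12.4, §17.13 (pp. 279–280) and (14.9.3) (p. 240)] -/
theorem lengthAt_fourTerm_accounting (loc : H →ₗ[R] P) (hloc : Function.Injective loc) (toX : P →ₗ[R] X)
    (hHP : Function.Exact loc toX) (π : X →ₗ[R] Y) (hX : Function.Exact toX π) (hπ : Function.Surjective π)
    (col : P →ₗ[R] R) (hcol : Function.Injective col) (z : H) (𝔭 : PrimeSpectrum R) :
    lengthAt R (H ⧸ (R ∙ z)) 𝔭 + lengthAt R X 𝔭 + lengthAt R (R ⧸ LinearMap.range col) 𝔭 =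
      lengthAt R (R ⧸ Ideal.span {col (loc z)}) 𝔭 + lengthAt R Y 𝔭 := by
  -- the four-term sequence `0 → H/Rz → P/R·loc z → X → Y → 0`
  set LH : Submodule R H := R ∙ z with hLH
  set LP : Submodule R P := R ∙ loc z with hLP
  have hmap : ∀ h ∈ LH, loc h ∈ LP := by
    intro h hh
    rw [hLH, Submodule.mem_span_singleton] at hh
    obtain ⟨a, rfl⟩ := hh
    rw [hLP, map_smul]
    exact Submodule.smul_mem _ a (Submodule.mem_span_singleton_self _)
  let ι : (H ⧸ LH) →ₗ[R] (P ⧸ LP) := Submodule.mapQ LH LP loc hmap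
  have hι : Function.Injective ι := by
    rw [← LinearMap.ker_eq_bot, Submodule.ker_mapQ, Submodule.eq_bot_iff]
    intro x hx
    rw [Submodule.mem_map] at hx
    obtain ⟨h, hh, rfl⟩ := hx
    rw [Submodule.mem_comap, hLP, Submodule.mem_span_singleton] at hh
    obtain ⟨a, ha⟩ := hh
    rw [← map_smul] at ha
    have : h = a • z := (hloc ha).symm
    rw [Submodule.mkQ_apply, Submodule.Quotient.mk_eq_zero, this, hLH]
    exact Submodule.smul_mem _ a (Submodule.mem_span_singleton_self _)
  have hle : LP ≤ LinearMap.ker toX := by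
    rw [hLP, Submodule.span_singleton_le_iff_mem, LinearMap.mem_ker]
    exact hHP.apply_apply_eq_zero z
  let f : (P ⧸ LP) →ₗ[R] X := LP.liftQ toX hle
  have hιf : Function.Exact ι f := by
    rw [LinearMap.exact_iff]
    apply le_antisymm
    · intro x hx
      obtain ⟨y, rfl⟩ := Submodule.Quotient.mk_surjective LP x
      have hy : toX y = 0 := hx
      obtain ⟨h, rfl⟩ := (hHP y).mp hy
      exact ⟨Submodule.Quotient.mk h, rfl⟩
    · rintro x ⟨x', rfl⟩
      obtain ⟨h, rfl⟩ := Submodule.Quotient.mk_surjective LH x'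
      change toX (loc h) = 0
      exact hHP.apply_apply_eq_zero h
  have hf : Function.Exact f π := by
    rw [LinearMap.exact_iff, Submodule.range_liftQ]
    exact LinearMap.exact_iff.mp hX
  have h4 := lengthAt_add_eq_of_fourTerm ι hι f hιf π hf hπ 𝔭
  have h5 := lengthAt_quotient_span_add_coker_eq col hcol (loc z) 𝔭
  rw [← h5, h4, add_right_comm]

end FourTerm

/-! ## §2 Over `Λ₀ = ℤ_p⟦T⟧` at `(p)` -/

section AtP

open Summit.BirchSwinnertonDyer.Rank1Residual.X1.MuLambda

variable (p : ℕ) [Fact p.Prime]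
  {H P X Y : Type*} [AddCommGroup H] [_root_.Module (IwasawaAlgebra p) H]
  [AddCommGroup P] [_root_.Module (IwasawaAlgebra p) P]
  [AddCommGroup X] [_root_.Module (IwasawaAlgebra p) X]
  [AddCommGroup Y] [_root_.Module (IwasawaAlgebra p) Y]

/-- **Exact accounting at `(p)` with a `p`-power defect in the zeta value**: `col (loc z) = p^e·s·G`, `s ∉ (p)`
give `ℓ(H/Λz) + ℓ(X) + ℓ(Λ/col P) = e + ℓ(Λ/(G)) + ℓ(Y)`.
[cite: Kato2004Asterisque, Thm. 12.4, Thm. 12.5 (4), §17.13 (pp. 227, 279–280)] -/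
theorem lengthAt_fourTerm_accounting_augIdealP (𝔭 : PrimeSpectrum (IwasawaAlgebra p))
    (h𝔭 : 𝔭.asIdeal = IwasawaAlgebra.augIdealP p) (loc : H →ₗ[IwasawaAlgebra p] P)
    (hloc : Function.Injective loc) (toX : P →ₗ[IwasawaAlgebra p] X) (hHP : Function.Exact loc toX)
    (π : X →ₗ[IwasawaAlgebra p] Y) (hX : Function.Exact toX π) (hπ : Function.Surjective π)
    (col : P →ₗ[IwasawaAlgebra p] IwasawaAlgebra p) (hcol : Function.Injective col) {z : H}
    {s G : IwasawaAlgebra p} {e : ℕ} (hs : s ∉ IwasawaAlgebra.augIdealP p)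
    (hz : col (loc z) = PowerSeries.C ((p : ℤ_[p]) ^ e) * s * G) :
    lengthAt (IwasawaAlgebra p) (H ⧸ (IwasawaAlgebra p ∙ z)) 𝔭 + lengthAt (IwasawaAlgebra p) X 𝔭 +
        lengthAt (IwasawaAlgebra p) (IwasawaAlgebra p ⧸ LinearMap.range col) 𝔭 =
      e + lengthAt (IwasawaAlgebra p) (IwasawaAlgebra p ⧸ Ideal.span {G}) 𝔭 +
        lengthAt (IwasawaAlgebra p) Y 𝔭 := by
  rw [lengthAt_fourTerm_accounting loc hloc toX hHP π hX hπ col hcol z 𝔭, hz,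
    lengthAt_quotient_span_C_pow_mul_mul p e hs G 𝔭 h𝔭]

end AtP

/-! ## §3 At `2`, per cyclotomic datum: the zeta index decides stub T on road (b) -/

section AtTwo

open WeierstrassCurve Summit.BirchSwinnertonDyer.Rank1Residual.X1.MuLambda

variable (W : WeierstrassCurve ℚ) {κ : ZpExtension ℚ 2} {γ : Field.absoluteGaloisGroup ℚ}

/-- **The zeta index at `2`, per datum.** `X = X(E/ℚ_∞)` (`D`), `X₀ = X₀(E/ℚ_∞)` (`Yd`). GIVEN (displayed, not
asserted): Kato's row over `ℚ_∞` with `𝐇 ↪ P` and `𝐇 → P → X` exact (Thm. 12.4: compact Selmer module zero),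
`P → X → X₀ → 0` exact, an injective Coleman map `col : P → Λ` whose cokernel has `(2)`-length `0` (Prop. 17.11 at
the anomalous prime `2`), the integral class `z` with `col (loc z) = 2^e·s·G₊`, `s ∉ (2)` (REF1 §57:
`e = [Δ_E > 0]`), the even-branch analytic `μ₂ = 0` (`red G₊ ≠ 0`) and statement (A) at `(E,2)` — THEN
`ℓ₍₂₎(𝐇/Λz) + ℓ₍₂₎(X(E/ℚ_∞)) = e`. [cite: Kato2004Asterisque, Thm. 12.4, Thm. 17.4 (1) (p. 273), Prop. 17.11 (p. 277), §17.13 (pp. 279–280)]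
[cite: CoatesSujatha2005, statement (A) (§3)] -/
theorem selmerDual_lengthAt_add_zetaIndex_eq_two (hγ : κ.IsTopGenerator γ) (D : W.SelmerDualData κ γ)
    (Yd : W.FineSelmerDualData κ γ) (hA : Set.Finite {s : W.fineSelmerInfty κ | 2 • s = 0})
    {G : IwasawaAlgebra 2} (hred : red G ≠ 0)
    {H P : Type*} [AddCommGroup H] [_root_.Module (IwasawaAlgebra 2) H]
    [AddCommGroup P] [_root_.Module (IwasawaAlgebra 2) P]
    (loc : H →ₗ[IwasawaAlgebra 2] P) (hloc : Function.Injective loc) (toX : P →ₗ[IwasawaAlgebra 2] D.X)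
    (hHP : Function.Exact loc toX) (π : D.X →ₗ[IwasawaAlgebra 2] Yd.X) (hX : Function.Exact toX π)
    (hπ : Function.Surjective π) (col : P →ₗ[IwasawaAlgebra 2] IwasawaAlgebra 2) (hcol : Function.Injective col)
    (hcoker : lengthAt (IwasawaAlgebra 2) (IwasawaAlgebra 2 ⧸ LinearMap.range col)
      ⟨IwasawaAlgebra.augIdealP 2, IwasawaAlgebra.isPrime_augIdealP_holds 2⟩ = 0)
    {z : H} {s : IwasawaAlgebra 2} {e : ℕ} (hs : s ∉ IwasawaAlgebra.augIdealP 2)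
    (hz : col (loc z) = PowerSeries.C ((2 : ℤ_[2]) ^ e) * s * G) :
    lengthAt (IwasawaAlgebra 2) (H ⧸ (IwasawaAlgebra 2 ∙ z))
        ⟨IwasawaAlgebra.augIdealP 2, IwasawaAlgebra.isPrime_augIdealP_holds 2⟩ +
      lengthAt (IwasawaAlgebra 2) D.X ⟨IwasawaAlgebra.augIdealP 2, IwasawaAlgebra.isPrime_augIdealP_holds 2⟩ =
        e := by
  let 𝔭 : PrimeSpectrum (IwasawaAlgebra 2) :=
    ⟨IwasawaAlgebra.augIdealP 2, IwasawaAlgebra.isPrime_augIdealP_holds 2⟩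
  have h := lengthAt_fourTerm_accounting_augIdealP 2 𝔭 rfl loc hloc toX hHP π hX hπ col hcol hs
    (by exact_mod_cast hz)
  have hYd : lengthAt (IwasawaAlgebra 2) Yd.X 𝔭 = 0 :=
    lengthAt_fineSelmerDual_eq_zero_of_finite_twoTorsion W hγ Yd hA
  have hq0 : lengthAt (IwasawaAlgebra 2) (IwasawaAlgebra 2 ⧸ Ideal.span {G}) 𝔭 = 0 :=
    lengthAt_quotient_eq_zero_of_not_le
      (by rw [Ideal.span_singleton_le_iff_mem]; exact not_mem_augIdealP_of_red_ne_zero hred)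
  have hc : lengthAt (IwasawaAlgebra 2) (IwasawaAlgebra 2 ⧸ LinearMap.range col) 𝔭 = 0 := hcoker
  rw [hc, hq0, hYd, add_zero, add_zero, add_zero] at h
  exact h

/-- **Corollary: on road (b) over `ℚ_∞`, `μ(X(E/ℚ_∞)) ≤ e`** (`= [Δ_E > 0]` for REF1 §57's class) modulo the
displayed data — `μ = 0` outright when `Δ_E < 0`, and at most ONE unit of `μ` at stake when `Δ_E > 0`.
[cite: Kato2004Asterisque, §17.13 (pp. 279–280)] [cite: CoatesSujatha2005, statement (A) (§3)] -/
theorem selmerDual_lengthAt_le_defect_two (hγ : κ.IsTopGenerator γ) (D : W.SelmerDualData κ γ)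
    (Yd : W.FineSelmerDualData κ γ) (hA : Set.Finite {s : W.fineSelmerInfty κ | 2 • s = 0})
    {G : IwasawaAlgebra 2} (hred : red G ≠ 0)
    {H P : Type*} [AddCommGroup H] [_root_.Module (IwasawaAlgebra 2) H]
    [AddCommGroup P] [_root_.Module (IwasawaAlgebra 2) P]
    (loc : H →ₗ[IwasawaAlgebra 2] P) (hloc : Function.Injective loc) (toX : P →ₗ[IwasawaAlgebra 2] D.X)
    (hHP : Function.Exact loc toX) (π : D.X →ₗ[IwasawaAlgebra 2] Yd.X) (hX : Function.Exact toX π)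
    (hπ : Function.Surjective π) (col : P →ₗ[IwasawaAlgebra 2] IwasawaAlgebra 2) (hcol : Function.Injective col)
    (hcoker : lengthAt (IwasawaAlgebra 2) (IwasawaAlgebra 2 ⧸ LinearMap.range col)
      ⟨IwasawaAlgebra.augIdealP 2, IwasawaAlgebra.isPrime_augIdealP_holds 2⟩ = 0)
    {z : H} {s : IwasawaAlgebra 2} {e : ℕ} (hs : s ∉ IwasawaAlgebra.augIdealP 2)
    (hz : col (loc z) = PowerSeries.C ((2 : ℤ_[2]) ^ e) * s * G) :
    lengthAt (IwasawaAlgebra 2) D.X ⟨IwasawaAlgebra.augIdealP 2, IwasawaAlgebra.isPrime_augIdealP_holds 2⟩ ≤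
      e := by
  have h := selmerDual_lengthAt_add_zetaIndex_eq_two W hγ D Yd hA hred loc hloc toX hHP π hX hπ col hcol hcoker
    hs hz
  exact le_of_add_le_right h.le

/-- **Stub T on road (b) ⟺ the zeta index.** Under the displayed data, `μ(X(E/ℚ_∞)) = 0` iff
`ℓ₍₂₎(𝐇/Λz) = e`, i.e. iff Kato's `ℚ_∞`-class is `μ`-divisible in `𝐇` by EXACTLY `2^{[Δ_E>0]}` (REF1 §62 (S1):
iff the real-signature map `𝐇 → Λ/2` is non-zero when `Δ_E > 0`, since a class corestricted from the totally
imaginary `ℚ(ζ_{2^∞})` has trivial real components). Nothing here asserts which side holds.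
[cite: Kato2004Asterisque, Thm. 12.4, §17.13 (pp. 279–280)] [cite: GreenbergLNM1716, Lemma 4.6 and pp. 98–99] -/
theorem selmerDual_mu_eq_zero_iff_zetaIndex_two (hγ : κ.IsTopGenerator γ) (D : W.SelmerDualData κ γ)
    (Yd : W.FineSelmerDualData κ γ) (hA : Set.Finite {s : W.fineSelmerInfty κ | 2 • s = 0})
    {G : IwasawaAlgebra 2} (hred : red G ≠ 0)
    {H P : Type*} [AddCommGroup H] [_root_.Module (IwasawaAlgebra 2) H]
    [AddCommGroup P] [_root_.Module (IwasawaAlgebra 2) P]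
    (loc : H →ₗ[IwasawaAlgebra 2] P) (hloc : Function.Injective loc) (toX : P →ₗ[IwasawaAlgebra 2] D.X)
    (hHP : Function.Exact loc toX) (π : D.X →ₗ[IwasawaAlgebra 2] Yd.X) (hX : Function.Exact toX π)
    (hπ : Function.Surjective π) (col : P →ₗ[IwasawaAlgebra 2] IwasawaAlgebra 2) (hcol : Function.Injective col)
    (hcoker : lengthAt (IwasawaAlgebra 2) (IwasawaAlgebra 2 ⧸ LinearMap.range col)
      ⟨IwasawaAlgebra.augIdealP 2, IwasawaAlgebra.isPrime_augIdealP_holds 2⟩ = 0)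
    {z : H} {s : IwasawaAlgebra 2} {e : ℕ} (hs : s ∉ IwasawaAlgebra.augIdealP 2)
    (hz : col (loc z) = PowerSeries.C ((2 : ℤ_[2]) ^ e) * s * G) :
    D.mu = 0 ↔
      lengthAt (IwasawaAlgebra 2) (H ⧸ (IwasawaAlgebra 2 ∙ z))
        ⟨IwasawaAlgebra.augIdealP 2, IwasawaAlgebra.isPrime_augIdealP_holds 2⟩ = e := by
  let 𝔭 : PrimeSpectrum (IwasawaAlgebra 2) :=
    ⟨IwasawaAlgebra.augIdealP 2, IwasawaAlgebra.isPrime_augIdealP_holds 2⟩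
  have h := selmerDual_lengthAt_add_zetaIndex_eq_two W hγ D Yd hA hred loc hloc toX hHP π hX hπ col hcol hcoker
    hs hz
  have hXle : lengthAt (IwasawaAlgebra 2) D.X 𝔭 ≤ (e : ℕ∞) := le_of_add_le_right h.le
  have hXne : lengthAt (IwasawaAlgebra 2) D.X 𝔭 ≠ ⊤ := ne_top_of_le_ne_top (ENat.coe_ne_top e) hXle
  have hmu : D.mu = 0 ↔ lengthAt (IwasawaAlgebra 2) D.X 𝔭 = 0 := by
    change muInvariant 2 D.X = 0 ↔ _
    rw [muInvariant_eq_toNat_lengthAt 2 D.X 𝔭 rfl, ENat.toNat_eq_zero]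
    exact ⟨fun h' => h'.resolve_right hXne, Or.inl⟩
  rw [hmu]
  constructor
  · intro h0
    rw [h0, add_zero] at h
    exact h
  · intro hH
    rw [hH] at h
    have h' : (e : ℕ∞) + lengthAt (IwasawaAlgebra 2) D.X 𝔭 ≤ (e : ℕ∞) + 0 := by
      rw [add_zero]; exact h.le
    exact nonpos_iff_eq_zero.mp ((ENat.add_le_add_iff_left (ENat.coe_ne_top e)).mp h')

end AtTwo

end Summit.BirchSwinnertonDyer.BirchSwinnertonDyer.Theorems.AlignedTransportAtTwoFineRoad

end
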